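import Summits.BirchSwinnertonDyer.BirchSwinnertonDyer.Theorems.SignedLowerHalvesKobayashiLowerHalfLargeImageSignDefectX7
import HarnessLib

/-!
# Route `SignedLowerHalves` (K3), child crux L `SmallImageLowerHalfBothSigns` (item stmt-BirchSwinnertonDyer-23599),
# line `birth_acns` v14, stub `stub_lambdaLowerThree_ns` (= retired item 23118 `SmallImageLambdaLowerAtThree`, VERBATIM):
# the λ-SEAM of the sign-defect identity — the stub's λ-inequality `λ(L_p^ε) ≤ λ(ξ^ε)` IS Kato's λ-inequality
# `λ(char 𝐇¹(T)/Z(T)) ≤ λ(char X₀)`, sign-free and `±`-free; on class X7 the sign of the λ-stub is IDLE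

Cell `bsd-ssimc`, width seat `bsd-line-slh-p3-w3` gen 6 (route-independent helper `--supports stmt-BirchSwinnertonDyer-23599`;
NO `Theses` import). HONEST FRAMING: TOOL THEOREMS ONLY — no definition, no named fact minted, no `sorry`, axioms standard;
every theorem on a curve is CONDITIONAL on DISPLAYED published inputs: Kobayashi 2003 Thm. 1.2 (`h12`, `X^ε` is `Λ`-torsion),
a displayed period unit `ord_p ϖ = 0` at the pair (`hper`; in the cone it is Greenberg–Vatsal Rem. 3.4 / Mazur 1978
Cor. 4.1 = `realPeriodRat_eq_unit_mul_plusPeriod{,_three}`), the Coleman–Kato package fact `hPkg`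
(`Kobayashi2003.thm62_63_73_signedColemanKato_zeta`, Thm. 6.2/6.3/7.3 i) + Kato Thm. 12.6) and, for the sign swap, the JOINT
package fact `Kobayashi2003.thm62_63_73_signedColemanKato_zetaJoint` (`hJ`, both signs on ONE zeta submodule `Z(T)`,
Kobayashi Thm. 5.2 iv) / proof of Thm. 7.4). Nothing here is a theorem about a curve unconditionally; the stub, crux L and
the route stay OPEN; BSD is not proved by any of this.

WHAT. The sibling seats put Kobayashi's proof of Thm. 7.4 in the kernel as ONE element identity on a package datum,
`z · g · w = C(u) · L^ε · y` (`SignDefect.mul_mul_eq_of_signedColemanKato`: `z`, `g`, `y` ANY generators of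
`char(𝐇¹/Z)`, `char X^ε`, `char X₀`; `w ∈ Λ^×`, `u ∈ ℤ_p^×`), and read off it the integral seam (class X6: slh-p2; class
X7: slh-p1, `SignDefect.X7.*`), the rational seam and the `μ`-seam (class X6 only). This file reads the **λ-SEAM**, which
is the currency of the p = 3 λ-stub of crux L (w3 g0: the stub ⟺ `λ(L_3^ε) ≤ λ(ξ^ε)` at every datum,
`SmallImageLambdaLowerThreeNs.smallImageLambdaLowerAtThree_iff_lamLe`):
* §1 algebra: along `z · g · w = C(u) · L · y` (all factors non-zero) `λ(z) + λ(g) = λ(L) + λ(y)`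
  (`lam_add_lam_eq_of_mul_mul_eq`), so `λ(L) ≤ λ(g) ⟺ λ(z) ≤ λ(y)` and the λ-DEFECT `λ(L) − λ(g) = λ(z) − λ(y)` does not
  see the sign (`lam_le_iff_of_mul_mul_eq`, `lam_sub_lam_eq_of_mul_mul_eq`).
* §2 pointwise on a package datum (any class, `E[p]` irreducible displayed): the λ-inequality `λ(L^ε) ≤ λ(g)` for the
  generators of `char X^ε` ⟺ `λ(z) ≤ λ(y)` for the generators of `char(𝐇¹/Z)` and `char X₀` (`lam_le_iff_lam_le`); the
  λ-defect of the signed side equals Kato's (`lam_sub_lam_eq_kato`).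
* §3 on class X7 (odd `p`, `a_p = 0`; `E[p]` irreducible automatic, Serre §1.11 Prop. 12; NO image hypothesis):
  `X7.forall_lamLe_iff_kato` — «`λ(L_p^ε) ≤ λ(ξ^ε)` at every frame / Pollack pair / dual datum of sign `ε`» ⟺ «`λ(char 𝐇¹/Z) ≤
  λ(char X₀)` on every sign-`ε` package» (Kato's Conjecture 12.10, λ-part, in `Λ ⊗ ℚ_p`); `X7.forall_lamLe_of_jointZ` — on a
  joint package one sign gives the other (`hJ` displayed); `X7.lam_add_lam_eq_of_jointZ` — the SIGN-FREE λ-DEFECT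
  `λ(L^{ε₁}) + λ(ξ₂) = λ(L^{ε₂}) + λ(ξ₁)` for dual data of two signs on one frame. The joint package BY NAME
  (`…_zetaJoint`, Tate-module instances discharged: `∃ ε ⟺ ∀ ε`, Kato currency at all signs, `λ(L_p^+) + λ(ξ^−) =
  λ(L_p^−) + λ(ξ^+)`) is the companion file `…LambdaLowerThreeNsKatoSigns.lean`; the by-name readings on crux L's domain are
  `…LambdaLowerThreeNsKatoResidue.lean`.
READING for crux L at `p = 3` (small image): the registered λ-stub is `∀ ε`, but it carries NO content beyond one sign; its
open content is Kato's rational main conjecture λ-part «the index of Kato's zeta element in `𝐇¹(T)` has the λ-invariant of the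
fine Selmer dual `X₀(E/ℚ_∞)`» on the small-image X7 class at `3` — no `±` object is involved.

References: [Kobayashi2003] Thm. 1.2 (p. 2), Thm. 5.2 iv) (p. 9), §5 (p. 10), Thm. 6.2/6.3 (p. 11), Thm. 7.3 i) (7.21),
Thm. 7.4 and its proof (p. 13); [Kato2004Asterisque] Thm. 12.5/12.6 (p. 222), Conj. 12.10 (p. 224); [GreenbergVatsal2000]
p. 4 (1)–(2), §3 Rem. 3.4; [Washington1997] §7.1; [Serre1972] §1.11 Prop. 12; [PerrinRiou2003] Conj. 7.1; [Pollack2003] Thm. 5.6.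
-/

set_option autoImplicit false
-- single-problem summit (D-0017): the doubled namespace component is by design
set_option linter.dupNamespace false

noncomputable section

open scoped Classical MatrixGroups ModularForm

open CongruenceSubgroup Field WeierstrassCurve Literature.NumberTheory.EllipticCurves
  Literature.NumberTheory.EllipticCurves.ModularForms Literature.NumberTheory.GaloisRepresentations
  Literature.NumberTheory.EllipticCurves.Rank1Residual
  Literature.NumberTheory.EllipticCurves.Rank1Residual.Typed
  Summit.BirchSwinnertonDyer.Rank1Residual.Supersingular
  Summit.BirchSwinnertonDyer.Rank1Residual.X1.MuLambda

namespace Summit.BirchSwinnertonDyer.BirchSwinnertonDyer.Theorems.SmallImageLambdaLowerThreeNsKato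

open SignDefect

/-! ## §1 Algebra: the λ-seam along `z · g · w = C(u) · L · y` -/

section Algebra

variable {p : ℕ} [Fact p.Prime]

/-- `λ(C(u)) = 0` for a `p`-adic unit `u` (a constant unit of `Λ`). [cite: Washington1997, §7.1] -/
theorem lam_C_units (u : ℤ_[p]ˣ) : lam (PowerSeries.C (u : ℤ_[p]) : IwasawaAlgebra p) = 0 :=
  ((isUnit_iff_mu_eq_zero_and_lam_eq_zero _).mp ((Units.isUnit u).map (PowerSeries.C (R := ℤ_[p])))).2.2

/-- `C(u) ≠ 0` in `Λ` for a `p`-adic unit `u`. [folklore] -/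
theorem C_units_ne_zero (u : ℤ_[p]ˣ) : (PowerSeries.C (u : ℤ_[p]) : IwasawaAlgebra p) ≠ 0 :=
  ((Units.isUnit u).map (PowerSeries.C (R := ℤ_[p]))).ne_zero

/-- **The λ-seam along `z · g · w = C(u) · L · y`** (`w ∈ Λ^×`, `u ∈ ℤ_p^×`, all of `z, g, L, y` non-zero):
`λ(z) + λ(g) = λ(L) + λ(y)` — `λ` is additive and vanishes on units. [cite: Washington1997, §7.1 (Weierstrass preparation)]
[cite: Kobayashi2003, proof of Thm. 7.4 (p. 13)] -/
theorem lam_add_lam_eq_of_mul_mul_eq {z g L y : IwasawaAlgebra p} (u : ℤ_[p]ˣ) (w : (IwasawaAlgebra p)ˣ)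
    (h : z * g * (w : IwasawaAlgebra p) = PowerSeries.C (u : ℤ_[p]) * L * y)
    (hz : z ≠ 0) (hg : g ≠ 0) (hL : L ≠ 0) (hy : y ≠ 0) :
    lam z + lam g = lam L + lam y := by
  have hw0 : (w : IwasawaAlgebra p) ≠ 0 := Units.ne_zero w
  -- a unit of `Λ` has `λ = 0` (tree: `TwoAdicTwistConverse.lam_units`; one line, not re-imported across routes)
  have hw : lam (w : IwasawaAlgebra p) = 0 := ((isUnit_iff_mu_eq_zero_and_lam_eq_zero _).mp (Units.isUnit w)).2.2
  have h1 : lam (z * g * (w : IwasawaAlgebra p)) = lam z + lam g := by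
    rw [lam_mul (mul_ne_zero hz hg) hw0, lam_mul hz hg, hw, add_zero]
  have h2 : lam (PowerSeries.C (u : ℤ_[p]) * L * y) = lam L + lam y := by
    rw [lam_mul (mul_ne_zero (C_units_ne_zero u) hL) hy, lam_mul (C_units_ne_zero u) hL, lam_C_units,
      zero_add]
  rw [← h1, ← h2, h]

/-- **The λ-inequality transfers across the identity**: `λ(L) ≤ λ(g) ⟺ λ(z) ≤ λ(y)`. [folklore]
[cite: Kobayashi2003, proof of Thm. 7.4 (p. 13)] -/
theorem lam_le_iff_of_mul_mul_eq {z g L y : IwasawaAlgebra p} (u : ℤ_[p]ˣ) (w : (IwasawaAlgebra p)ˣ)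
    (h : z * g * (w : IwasawaAlgebra p) = PowerSeries.C (u : ℤ_[p]) * L * y)
    (hz : z ≠ 0) (hg : g ≠ 0) (hL : L ≠ 0) (hy : y ≠ 0) :
    lam L ≤ lam g ↔ lam z ≤ lam y := by
  have := lam_add_lam_eq_of_mul_mul_eq u w h hz hg hL hy
  omega

/-- **The λ-DEFECT does not see which side it is read on**: `λ(L) − λ(g) = λ(z) − λ(y)` (in `ℤ`). [folklore]
[cite: Kobayashi2003, proof of Thm. 7.4 (p. 13)] [cite: GreenbergVatsal2000, p. 4, (1)–(2)] -/
theorem lam_sub_lam_eq_of_mul_mul_eq {z g L y : IwasawaAlgebra p} (u : ℤ_[p]ˣ) (w : (IwasawaAlgebra p)ˣ)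
    (h : z * g * (w : IwasawaAlgebra p) = PowerSeries.C (u : ℤ_[p]) * L * y)
    (hz : z ≠ 0) (hg : g ≠ 0) (hL : L ≠ 0) (hy : y ≠ 0) :
    (lam L : ℤ) - lam g = lam z - lam y := by
  have := lam_add_lam_eq_of_mul_mul_eq u w h hz hg hL hy
  omega

end Algebra

/-! ## §2 The λ-seam on one package datum (any class; `E[p]` irreducible displayed) -/

section Package

variable (W : WeierstrassCurve ℚ) [W.IsElliptic] [W.IsGloballyMinimal] (p : ℕ) [Fact p.Prime]
  [ContinuousSMul ℤ_[p] (W.tateModule p)] [Module.Free ℤ_[p] (W.tateModule p)]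
  [Module.Finite ℤ_[p] (W.tateModule p)]

omit [W.IsGloballyMinimal] in
/-- **λ-seam, pointwise.** In the frame of `SignDefect.mul_mul_eq_of_signedColemanKato` (`W/ℚ`, `p` odd good, `a_p = 0`,
`E[p]` irreducible; `κ, γ`; a newform `f` of `W`; a period ratio `ϖ` with `ord_p ϖ = 0`; a Pollack pair; a TORSION dual datum
`D` of `Sel^ε(E/ℚ_∞)`; a fine dual `Y`; a sign-`ε` Coleman–Kato package `d` on a pinned `I = 𝐇¹(T)`): the Eisenstein
λ-inequality `λ(L^ε) ≤ λ(g)` for every generator `g` of `char X^ε` holds IFF Kato's λ-inequality `λ(z) ≤ λ(y)` holds for all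
generators `z` of `char(𝐇¹/Z)` and `y` of `char X₀`. [cite: Kobayashi2003, proof of Thm. 7.4 (p. 13)]
[cite: Kato2004Asterisque, Conj. 12.10 (p. 224)] -/
theorem lam_le_iff_lam_le
    (hirr : W.HasIrreducibleModPGaloisRep p) {ε : ℤˣ}
    {κ : ZpExtension ℚ p} {γ : absoluteGaloisGroup ℚ} (hγ : κ.IsTopGenerator γ)
    {N : ℕ} [NeZero N] {f : CuspForm (Gamma0 N) 2} (hf : IsNewformOf W f)
    {ϖ : ℚ} (hϖ : (ϖ : ℝ) * W.realPeriodRat = plusPeriod f) (hvϖ : padicValRat p ϖ = 0)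
    {Lplus Lminus : IwasawaAlgebra p} (hL : IsPollackPair f p Lplus Lminus)
    (D : Kobayashi2003.SignedSelmerDualData W κ γ ε) (hDtor : Module.IsTorsion (IwasawaAlgebra p) D.X)
    {I : Kato2004.IwasawaH1Data W p κ γ}
    (Y : W.FineSelmerDualData κ γ) (d : Kobayashi2003.SignedColemanKatoData W p f ϖ κ γ ε I) :
    (∀ g : IwasawaAlgebra p, D.charIdeal = Ideal.span {g} → lam (kobayashiL ε Lplus Lminus) ≤ lam g) ↔
    ∀ z y : IwasawaAlgebra p, Module.charIdeal (IwasawaAlgebra p) (I.H ⧸ d.Z) = Ideal.span {z} →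
      Module.charIdeal (IwasawaAlgebra p) Y.X = Ideal.span {y} → lam z ≤ lam y := by
  set L : IwasawaAlgebra p := kobayashiL ε Lplus Lminus with hLdef
  have hL0 : L ≠ 0 := by
    rw [hLdef, kobayashiL]
    split_ifs
    · exact hL.2.1
    · exact hL.1
  constructor
  · intro h z y hz hy
    obtain ⟨g₀, hg₀⟩ := (charIdeal_isPrincipal_holds p D.X).principal
    have hg₀' : Module.charIdeal (IwasawaAlgebra p) D.X = Ideal.span {g₀} := hg₀
    obtain ⟨hz0, hg0, hy0, u, w, -, hzgw⟩ :=
      mul_mul_eq_of_signedColemanKato W p hirr hγ hf hϖ hvϖ hL D hDtor Y d hz hg₀' hy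
    exact (lam_le_iff_of_mul_mul_eq u w hzgw hz0 hg0 hL0 hy0).mp (h g₀ hg₀')
  · intro h g hchar
    have hchar' : Module.charIdeal (IwasawaAlgebra p) D.X = Ideal.span {g} := hchar
    obtain ⟨z, hz⟩ := (charIdeal_isPrincipal_holds p (I.H ⧸ d.Z)).principal
    obtain ⟨y, hy⟩ := (charIdeal_isPrincipal_holds p Y.X).principal
    have hz' : Module.charIdeal (IwasawaAlgebra p) (I.H ⧸ d.Z) = Ideal.span {z} := hz
    have hy' : Module.charIdeal (IwasawaAlgebra p) Y.X = Ideal.span {y} := hy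
    obtain ⟨hz0, hg0, hy0, u, w, -, hzgw⟩ :=
      mul_mul_eq_of_signedColemanKato W p hirr hγ hf hϖ hvϖ hL D hDtor Y d hz' hchar' hy'
    exact (lam_le_iff_of_mul_mul_eq u w hzgw hz0 hg0 hL0 hy0).mpr (h z y hz' hy')

omit [W.IsGloballyMinimal] in
/-- **The λ-defect of the signed side IS Kato's λ-defect, pointwise.** Same frame: for ANY generators `g` of `char X^ε`,
`z` of `char(𝐇¹/Z)`, `y` of `char X₀`: `λ(L^ε) − λ(g) = λ(z) − λ(y)` — the right-hand side does not mention the sign `ε`, the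
Pollack pair, or any `±` object. [cite: Kobayashi2003, proof of Thm. 7.4 (p. 13)] [cite: Kato2004Asterisque, Conj. 12.10 (p. 224)]
[cite: GreenbergVatsal2000, p. 4, (1)–(2)] -/
theorem lam_sub_lam_eq_kato
    (hirr : W.HasIrreducibleModPGaloisRep p) {ε : ℤˣ}
    {κ : ZpExtension ℚ p} {γ : absoluteGaloisGroup ℚ} (hγ : κ.IsTopGenerator γ)
    {N : ℕ} [NeZero N] {f : CuspForm (Gamma0 N) 2} (hf : IsNewformOf W f)
    {ϖ : ℚ} (hϖ : (ϖ : ℝ) * W.realPeriodRat = plusPeriod f) (hvϖ : padicValRat p ϖ = 0)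
    {Lplus Lminus : IwasawaAlgebra p} (hL : IsPollackPair f p Lplus Lminus)
    (D : Kobayashi2003.SignedSelmerDualData W κ γ ε) (hDtor : Module.IsTorsion (IwasawaAlgebra p) D.X)
    {I : Kato2004.IwasawaH1Data W p κ γ}
    (Y : W.FineSelmerDualData κ γ) (d : Kobayashi2003.SignedColemanKatoData W p f ϖ κ γ ε I)
    {g z y : IwasawaAlgebra p} (hg : D.charIdeal = Ideal.span {g})
    (hz : Module.charIdeal (IwasawaAlgebra p) (I.H ⧸ d.Z) = Ideal.span {z})
    (hy : Module.charIdeal (IwasawaAlgebra p) Y.X = Ideal.span {y}) :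
    (lam (kobayashiL ε Lplus Lminus) : ℤ) - lam g = lam z - lam y := by
  have hL0 : kobayashiL ε Lplus Lminus ≠ 0 := by
    rw [kobayashiL]
    split_ifs
    · exact hL.2.1
    · exact hL.1
  have hg' : Module.charIdeal (IwasawaAlgebra p) D.X = Ideal.span {g} := hg
  obtain ⟨hz0, hg0, hy0, u, w, -, hzgw⟩ :=
    mul_mul_eq_of_signedColemanKato W p hirr hγ hf hϖ hvϖ hL D hDtor Y d hz hg' hy
  exact lam_sub_lam_eq_of_mul_mul_eq u w hzgw hz0 hg0 hL0 hy0

end Package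

/-! ## §3 On class X7 (odd `p`, `a_p = 0`; `ρ̄` irreducible automatic, NO image hypothesis): the λ-stub's currency is Kato's,
and its sign is idle -/

section X7

variable (W : WeierstrassCurve ℚ) [W.IsElliptic] [W.IsGloballyMinimal] (p : ℕ) [Fact p.Prime]
  [ContinuousSMul ℤ_[p] (W.tateModule p)] [Module.Free ℤ_[p] (W.tateModule p)]
  [Module.Finite ℤ_[p] (W.tateModule p)]

/-- **The λ-inequality at sign `ε` ⟺ Kato's λ-inequality on every sign-`ε` package** (class X7, odd `p`, `a_p = 0`), granted
Kobayashi Thm. 1.2 (`h12`), a period unit at the pair (`hper`: `ord_p ϖ = 0` for every period ratio `ϖ` of the level-`N_E`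
newform — Greenberg–Vatsal Rem. 3.4 / Mazur 1978 Cor. 4.1 in the cone) and the package fact `hPkg` (Kobayashi Thm.
6.2/6.3/7.3 i) + Kato 12.6); Pollack's pair exists unconditionally; `E[p]` irreducible is automatic (`ClassX7.irr`). LHS =
«`λ(L_p^ε) ≤ λ(ξ^ε)` for every frame, the newform, every period ratio, every Pollack pair, every dual datum of sign `ε` and every
generator» (the currency of w3 g0's `smallImageLambdaLowerAtThree_iff_lamLe`); RHS = «`λ(z) ≤ λ(y)` for every frame, newform,
period ratio, every `I`, `Y`, sign-`ε` package `d` and all generators `z` of `char(𝐇¹/Z)`, `y` of `char X₀`» — Kato's Conjecture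
12.10 read in `Λ ⊗ ℚ_p` through `λ`. No image hypothesis. [cite: Kobayashi2003, Thm. 1.2, Thm. 7.4 and its proof (p. 13)]
[cite: Kato2004Asterisque, Conj. 12.10 (p. 224)] [cite: Serre1972, §1.11 Prop. 12] [cite: Pollack2003, Thm. 5.6] -/
theorem X7.forall_lamLe_iff_kato
    (h12 : Kobayashi2003.thm12_signedSelmerDual_finite_torsion)
    (hper : ∀ [NeZero (W.conductorNorm ℤ)] (f : CuspForm (Gamma0 (W.conductorNorm ℤ)) 2) (ϖ : ℚ),
      IsNewformOf W f → (ϖ : ℝ) * W.realPeriodRat = plusPeriod f → padicValRat p ϖ = 0)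
    (hPkg : Kobayashi2003.thm62_63_73_signedColemanKato_zeta)
    (hp : p ≠ 2) (hX : ClassX7 W p) (hap : W.frobeniusTrace p = 0) (ε : ℤˣ) :
    (∀ (κ : ZpExtension ℚ p) (γ : absoluteGaloisGroup ℚ),
        κ.IsCyclotomic → κ.IsTopGenerator γ → IsCyclotomicVariable p γ →
      ∀ [NeZero (W.conductorNorm ℤ)] (f : CuspForm (Gamma0 (W.conductorNorm ℤ)) 2),
        IsNewformOf W f → ∀ (ϖ : ℚ), (ϖ : ℝ) * W.realPeriodRat = plusPeriod f →
      ∀ (Lplus Lminus : IwasawaAlgebra p), IsPollackPair f p Lplus Lminus →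
      ∀ (D : Kobayashi2003.SignedSelmerDualData W κ γ ε) (ξ : IwasawaAlgebra p),
        D.charIdeal = Ideal.span {ξ} → lam (kobayashiL ε Lplus Lminus) ≤ lam ξ) ↔
    ∀ (κ : ZpExtension ℚ p) (γ : absoluteGaloisGroup ℚ),
        κ.IsCyclotomic → κ.IsTopGenerator γ → IsCyclotomicVariable p γ →
      ∀ [NeZero (W.conductorNorm ℤ)] (f : CuspForm (Gamma0 (W.conductorNorm ℤ)) 2),
        IsNewformOf W f → ∀ (ϖ : ℚ), (ϖ : ℝ) * W.realPeriodRat = plusPeriod f →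
      ∀ (I : Kato2004.IwasawaH1Data W p κ γ) (Y : W.FineSelmerDualData κ γ)
        (d : Kobayashi2003.SignedColemanKatoData W p f ϖ κ γ ε I) (z y : IwasawaAlgebra p),
        Module.charIdeal (IwasawaAlgebra p) (I.H ⧸ d.Z) = Ideal.span {z} →
        Module.charIdeal (IwasawaAlgebra p) Y.X = Ideal.span {y} → lam z ≤ lam y := by
  have hgood := hX.1.1
  have hirr := ClassX7.irr W p hp hX
  constructor
  · intro h κ γ hκ hγ hv _ f hf ϖ hϖ I Y d z y hz hy
    obtain ⟨Lplus, Lminus, hL⟩ :=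
      exists_isPollackPair pollack_exists_plusMinusPAdicLFunction_holds hp hf hgood hap
    obtain ⟨D⟩ := Kobayashi2003.nonempty_signedSelmerDualData W κ ε hγ
    obtain ⟨-, hDtor⟩ := h12 W p hp hgood hap κ γ hκ hγ ε D
    have hvϖ : padicValRat p ϖ = 0 := hper f ϖ hf hϖ
    exact (lam_le_iff_lam_le W p hirr hγ hf hϖ hvϖ hL D hDtor Y d).mp
      (h κ γ hκ hγ hv f hf ϖ hϖ Lplus Lminus hL D) z y hz hy
  · intro h κ γ hκ hγ hv _ f hf ϖ hϖ Lplus Lminus hL D ξ hξ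
    obtain ⟨I⟩ := Kato2004.nonempty_iwasawaH1Data_holds W p κ γ hκ hγ
    obtain ⟨Y⟩ := W.nonempty_fineSelmerDualData κ hγ
    obtain ⟨d⟩ := hPkg W p f ϖ κ γ hp hgood hap hf hϖ hκ hγ hv ε I
    obtain ⟨-, hDtor⟩ := h12 W p hp hgood hap κ γ hκ hγ ε D
    have hvϖ : padicValRat p ϖ = 0 := hper f ϖ hf hϖ
    exact (lam_le_iff_lam_le W p hirr hγ hf hϖ hvϖ hL D hDtor Y d).mpr
      (h κ γ hκ hγ hv f hf ϖ hϖ I Y d) ξ hξ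

/-- **Sign swap on a JOINT package** (class X7, odd `p`, `a_p = 0`; `h12`/`hper` as above; `hJ` displayed: for every frame and
every pinned `I` there are package data of signs `ε₁`, `ε₂` with THE SAME zeta submodule). Then the λ-inequality at sign `ε₁`
(every frame / Pollack pair / datum / generator) gives it at sign `ε₂`: it gives Kato's λ-inequality on `𝐇¹/Z`, which is
sign-free, and that gives the λ-inequality at `ε₂`. No image hypothesis. [cite: Kobayashi2003, Thm. 7.4 and its proof (p. 13), §5 (p. 10)]
[cite: Serre1972, §1.11 Prop. 12] -/
theorem X7.forall_lamLe_of_jointZ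
    (h12 : Kobayashi2003.thm12_signedSelmerDual_finite_torsion)
    (hper : ∀ [NeZero (W.conductorNorm ℤ)] (f : CuspForm (Gamma0 (W.conductorNorm ℤ)) 2) (ϖ : ℚ),
      IsNewformOf W f → (ϖ : ℝ) * W.realPeriodRat = plusPeriod f → padicValRat p ϖ = 0)
    (hp : p ≠ 2) (hX : ClassX7 W p) (hap : W.frobeniusTrace p = 0) {ε₁ ε₂ : ℤˣ}
    (hJ : ∀ (κ : ZpExtension ℚ p) (γ : absoluteGaloisGroup ℚ),
      κ.IsCyclotomic → κ.IsTopGenerator γ → IsCyclotomicVariable p γ →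
      ∀ [NeZero (W.conductorNorm ℤ)] (f : CuspForm (Gamma0 (W.conductorNorm ℤ)) 2),
        IsNewformOf W f → ∀ (ϖ : ℚ), (ϖ : ℝ) * W.realPeriodRat = plusPeriod f →
      ∀ (I : Kato2004.IwasawaH1Data W p κ γ),
        ∃ (d₁ : Kobayashi2003.SignedColemanKatoData W p f ϖ κ γ ε₁ I)
          (d₂ : Kobayashi2003.SignedColemanKatoData W p f ϖ κ γ ε₂ I), d₁.Z = d₂.Z)
    (h : ∀ (κ : ZpExtension ℚ p) (γ : absoluteGaloisGroup ℚ),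
        κ.IsCyclotomic → κ.IsTopGenerator γ → IsCyclotomicVariable p γ →
      ∀ [NeZero (W.conductorNorm ℤ)] (f : CuspForm (Gamma0 (W.conductorNorm ℤ)) 2),
        IsNewformOf W f → ∀ (ϖ : ℚ), (ϖ : ℝ) * W.realPeriodRat = plusPeriod f →
      ∀ (Lplus Lminus : IwasawaAlgebra p), IsPollackPair f p Lplus Lminus →
      ∀ (D : Kobayashi2003.SignedSelmerDualData W κ γ ε₁) (ξ : IwasawaAlgebra p),
        D.charIdeal = Ideal.span {ξ} → lam (kobayashiL ε₁ Lplus Lminus) ≤ lam ξ) :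
    ∀ (κ : ZpExtension ℚ p) (γ : absoluteGaloisGroup ℚ),
        κ.IsCyclotomic → κ.IsTopGenerator γ → IsCyclotomicVariable p γ →
      ∀ [NeZero (W.conductorNorm ℤ)] (f : CuspForm (Gamma0 (W.conductorNorm ℤ)) 2),
        IsNewformOf W f → ∀ (ϖ : ℚ), (ϖ : ℝ) * W.realPeriodRat = plusPeriod f →
      ∀ (Lplus Lminus : IwasawaAlgebra p), IsPollackPair f p Lplus Lminus →
      ∀ (D : Kobayashi2003.SignedSelmerDualData W κ γ ε₂) (ξ : IwasawaAlgebra p),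
        D.charIdeal = Ideal.span {ξ} → lam (kobayashiL ε₂ Lplus Lminus) ≤ lam ξ := by
  have hgood := hX.1.1
  have hirr := ClassX7.irr W p hp hX
  intro κ γ hκ hγ hv _ f hf ϖ hϖ Lplus Lminus hL D₂ ξ hξ
  obtain ⟨I⟩ := Kato2004.nonempty_iwasawaH1Data_holds W p κ γ hκ hγ
  obtain ⟨Y⟩ := W.nonempty_fineSelmerDualData κ hγ
  obtain ⟨d₁, d₂, hZ⟩ := hJ κ γ hκ hγ hv f hf ϖ hϖ I
  obtain ⟨D₁⟩ := Kobayashi2003.nonempty_signedSelmerDualData W κ ε₁ hγ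
  obtain ⟨-, hD₁tor⟩ := h12 W p hp hgood hap κ γ hκ hγ ε₁ D₁
  obtain ⟨-, hD₂tor⟩ := h12 W p hp hgood hap κ γ hκ hγ ε₂ D₂
  have hvϖ : padicValRat p ϖ = 0 := hper f ϖ hf hϖ
  have hK₁ := (lam_le_iff_lam_le W p hirr hγ hf hϖ hvϖ hL D₁ hD₁tor Y d₁).mp
    (h κ γ hκ hγ hv f hf ϖ hϖ Lplus Lminus hL D₁)
  rw [charIdeal_quot_eq_of_Z_eq W p d₁ d₂ hZ] at hK₁
  exact (lam_le_iff_lam_le W p hirr hγ hf hϖ hvϖ hL D₂ hD₂tor Y d₂).mpr hK₁ ξ hξ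

/-- **The SIGN-FREE λ-DEFECT on a joint package** (class X7, odd `p`, `a_p = 0`; `h12`/`hper`; `hJ` displayed for the signs
`ε₁`, `ε₂`): for every frame, Pollack pair, dual data `D₁` (sign `ε₁`) and `D₂` (sign `ε₂`) with generators `ξ₁`, `ξ₂`:
`λ(L^{ε₁}) + λ(ξ₂) = λ(L^{ε₂}) + λ(ξ₁)` — both λ-defects equal Kato's `λ(z) − λ(y)` on the common `𝐇¹/Z`. No image hypothesis.
[cite: Kobayashi2003, Thm. 7.4 and its proof (p. 13), §5 (p. 10)] [cite: GreenbergVatsal2000, p. 4, (1)–(2)] -/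
theorem X7.lam_add_lam_eq_of_jointZ
    (h12 : Kobayashi2003.thm12_signedSelmerDual_finite_torsion)
    (hper : ∀ [NeZero (W.conductorNorm ℤ)] (f : CuspForm (Gamma0 (W.conductorNorm ℤ)) 2) (ϖ : ℚ),
      IsNewformOf W f → (ϖ : ℝ) * W.realPeriodRat = plusPeriod f → padicValRat p ϖ = 0)
    (hp : p ≠ 2) (hX : ClassX7 W p) (hap : W.frobeniusTrace p = 0) {ε₁ ε₂ : ℤˣ}
    {κ : ZpExtension ℚ p} {γ : absoluteGaloisGroup ℚ} (hκ : κ.IsCyclotomic) (hγ : κ.IsTopGenerator γ)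
    [NeZero (W.conductorNorm ℤ)] {f : CuspForm (Gamma0 (W.conductorNorm ℤ)) 2}
    (hf : IsNewformOf W f) {ϖ : ℚ} (hϖ : (ϖ : ℝ) * W.realPeriodRat = plusPeriod f)
    {I : Kato2004.IwasawaH1Data W p κ γ} (d₁ : Kobayashi2003.SignedColemanKatoData W p f ϖ κ γ ε₁ I)
    (d₂ : Kobayashi2003.SignedColemanKatoData W p f ϖ κ γ ε₂ I) (hZ : d₁.Z = d₂.Z)
    {Lplus Lminus : IwasawaAlgebra p} (hL : IsPollackPair f p Lplus Lminus)
    (D₁ : Kobayashi2003.SignedSelmerDualData W κ γ ε₁) (D₂ : Kobayashi2003.SignedSelmerDualData W κ γ ε₂)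
    {ξ₁ ξ₂ : IwasawaAlgebra p} (hξ₁ : D₁.charIdeal = Ideal.span {ξ₁}) (hξ₂ : D₂.charIdeal = Ideal.span {ξ₂}) :
    lam (kobayashiL ε₁ Lplus Lminus) + lam ξ₂ = lam (kobayashiL ε₂ Lplus Lminus) + lam ξ₁ := by
  have hgood := hX.1.1
  have hirr := ClassX7.irr W p hp hX
  obtain ⟨Y⟩ := W.nonempty_fineSelmerDualData κ hγ
  obtain ⟨-, hD₁tor⟩ := h12 W p hp hgood hap κ γ hκ hγ ε₁ D₁
  obtain ⟨-, hD₂tor⟩ := h12 W p hp hgood hap κ γ hκ hγ ε₂ D₂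
  have hvϖ : padicValRat p ϖ = 0 := hper f ϖ hf hϖ
  obtain ⟨z, hz⟩ := (charIdeal_isPrincipal_holds p (I.H ⧸ d₁.Z)).principal
  obtain ⟨y, hy⟩ := (charIdeal_isPrincipal_holds p Y.X).principal
  have hz₁ : Module.charIdeal (IwasawaAlgebra p) (I.H ⧸ d₁.Z) = Ideal.span {z} := hz
  have hz₂ : Module.charIdeal (IwasawaAlgebra p) (I.H ⧸ d₂.Z) = Ideal.span {z} := by
    rw [← charIdeal_quot_eq_of_Z_eq W p d₁ d₂ hZ]; exact hz₁
  have hy' : Module.charIdeal (IwasawaAlgebra p) Y.X = Ideal.span {y} := hy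
  have e₁ := lam_sub_lam_eq_kato W p hirr hγ hf hϖ hvϖ hL D₁ hD₁tor Y d₁ hξ₁ hz₁ hy'
  have e₂ := lam_sub_lam_eq_kato W p hirr hγ hf hϖ hvϖ hL D₂ hD₂tor Y d₂ hξ₂ hz₂ hy'
  omega

end X7

end Summit.BirchSwinnertonDyer.BirchSwinnertonDyer.Theorems.SmallImageLambdaLowerThreeNsKato

end
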